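import Summits.NavierStokesRegularity.OSWSelfSimilar.SheetREvansEven
import Summits.NavierStokesRegularity.OSWSelfSimilar.SheetRSpectrumEvenWindingLists
import Summits.NavierStokesRegularity.OSWSelfSimilar.CertificateViscousSheetRSpectrumEven
import HarnessLib

/-!
# SHEET-ℝ, EVEN ZERO-MASS class `E⁺₀`: (P8⁺) of the Z3-SR-SPEC spectral certificate — the `Ω* − Ω̄` PERTURBATION BOOKKEEPING in the kernel:
# Gårding-datum transfer and the cross-`K` second resolvent identity under a bounded perturbation `K ↦ K + B` on `GardingDataKE`,
# and the even Evans allowance `‖E⁺* − E⁺‖ ≤ pert ≤ 1107/200000` DISCHARGED from `‖K' − K‖ ≤ Δ⁺/2`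

HONEST FRAMING (cell ns-blowup GROUP B / zone Z3, case Z3-SR-SPEC EVEN half, HYPOTHESIS-LEDGER row (P8⁺) «the `Ω* − Ω̄` allowance `pert⁺`»;
1-D MODEL certificate frame (viscous gCLM/OSW sheet on the line at `(a, c_l, ε) = (1/5, 1/2, 1)`); computer-assisted elsewhere, NOT here; not
Euler/NS; «violates: none — MODEL»).  Nothing here asserts that a profile exists; the (S1⁺) Gårding datum at the CENTRE (`GardingDataKE … K … c m`,
selfsim g14's hypothesis structure, `K : EspE →L W` ARBITRARY) is the HYPOTHESIS.  This is the EVEN twin of cert-5 g6's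
`SheetRLinearisationPerturbation` §§1–2 (odd class), written on selfsim g14's even dictionary (`pairOpKE`, `resolventKE`, `resolventEven`, `evansEven`):
* §1 **Gårding transfer** (`gardingDataKE_add_of_lower`, `gardingDataKE_add_of_norm_le`): a datum `(c, m)` for `K` and `‖B‖ ≤ b`, `2b < c` give the
  datum `(c − 2b, m − b/2)` for `K + B` (zero-mass even tests; `‖jmapE v‖² = ‖v₁‖²_w + ¼‖v‖²_w`, `|∫ w g v| ≤ 2‖g‖‖jmapE v‖`);
* §2 **cross-`K` second resolvent identity** (`pairOpKE_cross`, `resolventKE_sub_cross`): for two data with the same drift/potential and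
  perturbations `K`, `K'`, `R⁺_K(σ)G − R⁺_{K'}(σ)G = R⁺_{K'}(σ)·ofPair (KpairE (K' − K) (pairOpKE_K σ G))` (`Re σ > −m, −m'`; weak uniqueness
  `pairOpKE_unique`), the bound `‖R⁺_K(σ)G − R⁺_{K'}(σ)G‖ ≤ ‖K' − K‖·(4/κ_c(σ))·‖G‖/(m' + Re σ)` and its Evans forms on `L²_w(ℂ)` and on the class
  (`norm_inner_resolventKE_sub_cross_le`, `norm_evansEven_sub_le`);
* §3 **the (P8⁺) allowance DISCHARGED** (`evansEven_pert_of_norm_le`, `pert_of_record_leE`, `evansEven_pert_of_record`): with `θ = 4`, `f = h⁺` of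
  `‖h⁺‖²_w ≤ hw2E`, a centre datum `(c, m)` with `c ≥ c₂ = 1/5`, `m ≥ c₁ + γ = 3/20`, and `‖K' − K‖ ≤ Δ⁺/2` (`Δ⁺ = DeltaE = LlipE·rE♯₂` of
  `CertificateViscousSheetRSpectrumEven`), the datum `(c − Δ⁺, m − Δ⁺/4)` for `K'` (`gardingDataKE_of_norm_sub_le`) satisfies `−(m − Δ⁺/4) < −3/100`,
  and for every `w` with `Re w ≥ −3/100`: `‖E⁺_{K'}(w) − E⁺_K(w)‖ ≤ 4·(4·hw2E·(Δ⁺/2)·20)/(3/25 − Δ⁺/4) ≤ 1107/200000` (value ≈ 0.00462) — i.e. the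
  hypotheses `hpert`/`hpert'` of selfsim g14's even assembly (`SheetRSpectrumEvenAssembly.eigen_iff_eq_half`, keyed on cert-2 g10's
  `SheetRSpectrumEvenPointAssembly.eq_half_of_pointDataE`, `pert ≤ 1107/200000`) hold for `K' := K + B`, `‖B‖ ≤ Δ⁺/2`, BY THE KERNEL.
What stays PAPER/interval: the (S1⁺) datum itself and the point/far records; what the sheet's own `B = D²G⁺(Ω̄)[u, ·]` is and that `‖B‖ ≤ Δ⁺/2`
for `‖u‖_E ≤ rE♯₂` is the companion file `SheetREvenAssemblyOperators` (cert-5 g9).  No definition; no named fact; no `Prop` hypothesis beyond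
selfsim's `GardingDataKE`.  WHAT THIS IS NOT: not NS; not the spectral certificate; no number of record moves.
-/

noncomputable section

namespace Summit.NavierStokesRegularity.OSWSelfSimilar
namespace SheetREvenLinearisationPerturbation

open _root_.MeasureTheory _root_.Set _root_.Filter _root_.Real SheetRWeakProfilePV SheetRWeakToStrong SheetREnergyClass SheetRWeightedMeasure
  SheetRLinearisedTests SheetREnergySpace SheetRTestSpace SheetRLinearisedFormBounds SheetREvenTests SheetREvenEnergySpace SheetREvenForms
  SheetREvenPairOperator SheetREvenPairUniqueness SheetREvenResolvent SheetREvenResolventIdentity SheetREvenClass SheetRResolventEvenClass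
  SheetREvansEven SheetRComplexPivot SheetRSpectrumEvenWindingLists
open scoped Topology ENNReal InnerProductSpace

variable {L D₀ D₁ V₀ c m c' m' : ℝ} {d V : ℝ → ℝ} {hL : 0 < L} {K K' : EspE L hL →L[ℝ] W L}

/-! ### §1 Gårding-datum transfer under a bounded perturbation `K ↦ K + B` -/

/-- The data integral against a zero-mass even test IS the pairing `PdataE`: `∫ w g v = PdataE hL g ((v, v₁), _)`. [folklore] -/
theorem integral_weight_mul_eq_PdataE (hL : 0 < L) (g : W L) {v v₁ : ℝ → ℝ} (hv : IsCompactTestE v v₁) (h0 : ∫ y, v y = 0) :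
    ∫ y, (L ^ 2 + y ^ 2) * ((g : ℝ → ℝ) y * v y) = PdataE hL g ⟨(v, v₁), hv, h0⟩ :=
  (PdataE_apply hL g ⟨(v, v₁), hv, h0⟩).symm

/-- **Gårding transfer, form version.** If `(c, m)` is a Gårding datum for `K` and the added operator `B : E⁺₀ → L²_w` satisfies the one-sided
form bound `−β‖jmapE v‖² ≤ ∫ w B(jmapE v)·v` on zero-mass even tests, `β < c`, then `(c − β, m − β/4)` is a Gårding datum for `K + B`
(`‖jmapE v‖² = ‖v₁‖²_w + ¼‖v‖²_w`). [folklore] -/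
theorem gardingDataKE_add_of_lower (h : GardingDataKE L hL d V K D₀ D₁ V₀ c m) (B : EspE L hL →L[ℝ] W L) {β : ℝ}
    (hB : ∀ vp : testSpaceE0, -(β * ‖jmapE hL vp‖ ^ 2) ≤ PdataE hL (B (jmapE hL vp)) vp) (hβ : β < c) :
    GardingDataKE L hL d V (K + B) D₀ D₁ V₀ (c - β) (m - β / 4) where
  d_meas := h.d_meas
  V_meas := h.V_meas
  D₀_nonneg := h.D₀_nonneg
  D₁_nonneg := h.D₁_nonneg
  d_le := h.d_le
  V_le := h.V_le
  c_pos := by linarith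
  garding vp := by
    have hG := h.garding vp
    have hb := hB vp
    rw [sq_norm_jmapE] at hb
    rw [← PdataE_apply hL] at hG
    rw [← PdataE_apply hL, _root_.add_apply, map_add, LinearMap.add_apply]
    have key : (c - β) * (∫ ξ, (L ^ 2 + ξ ^ 2) * vp.1.2 ξ ^ 2) + (m - β / 4) * ∫ ξ, (L ^ 2 + ξ ^ 2) * vp.1.1 ξ ^ 2 =
        (c * (∫ ξ, (L ^ 2 + ξ ^ 2) * vp.1.2 ξ ^ 2) + m * ∫ ξ, (L ^ 2 + ξ ^ 2) * vp.1.1 ξ ^ 2)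
          - β * (1 / 4 * (∫ ξ, (L ^ 2 + ξ ^ 2) * vp.1.1 ξ ^ 2) + ∫ ξ, (L ^ 2 + ξ ^ 2) * vp.1.2 ξ ^ 2) := by ring
    rw [key]
    linarith

/-- **Gårding transfer, operator-norm version.** If `(c, m)` is a Gårding datum for `K` and `‖B‖_{E⁺₀→L²_w} ≤ b` with `2b < c`, then
`(c − 2b, m − b/2)` is a Gårding datum for `K + B`: `∫ w B(jmapE v)·v ≥ −2‖B(jmapE v)‖_w‖jmapE v‖ ≥ −2b‖jmapE v‖²` (`abs_PdataE_le`).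
With `b = Δ⁺/2`, `c = c₂`, `m = c₁ + γ` this is the even (P8⁺) S1 clause «`q⁺*_γ ≥ (c₁ − Δ⁺/4)‖δ‖²_w + (c₂ − Δ⁺)‖δ′‖²_w`». [folklore] -/
theorem gardingDataKE_add_of_norm_le (h : GardingDataKE L hL d V K D₀ D₁ V₀ c m) (B : EspE L hL →L[ℝ] W L) {b : ℝ}
    (hB : ‖B‖ ≤ b) (hb : 2 * b < c) : GardingDataKE L hL d V (K + B) D₀ D₁ V₀ (c - 2 * b) (m - b / 2) := by
  have key := gardingDataKE_add_of_lower h B (β := 2 * b) (fun vp => ?_) hb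
  · have e : (2 * b) / 4 = b / 2 := by ring
    rw [e] at key
    exact key
  · have h1 := (abs_le.1 (abs_PdataE_le hL (B (jmapE hL vp)) vp)).1
    have h2 : ‖B (jmapE hL vp)‖ ≤ b * ‖jmapE hL vp‖ := (B.le_opNorm _).trans (by gcongr)
    have h3 := mul_le_mul_of_nonneg_right h2 (norm_nonneg (jmapE hL vp))
    nlinarith [norm_nonneg (jmapE hL vp), norm_nonneg (B (jmapE hL vp))]

/-- **Gårding transfer for a REPLACEMENT `K ↦ K'` with `‖K' − K‖ ≤ b`, `2b < c`**: `(c − 2b, m − b/2)` is a datum for `K'` (`K' = K + (K' − K)`). [folklore] -/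
theorem gardingDataKE_of_norm_sub_le (h : GardingDataKE L hL d V K D₀ D₁ V₀ c m) (K' : EspE L hL →L[ℝ] W L) {b : ℝ}
    (hB : ‖K' - K‖ ≤ b) (hb : 2 * b < c) : GardingDataKE L hL d V K' D₀ D₁ V₀ (c - 2 * b) (m - b / 2) := by
  have key := gardingDataKE_add_of_norm_le h (K' - K) hB hb
  rwa [add_sub_cancel] at key

/-! ### §2 The cross-`K` second resolvent identity and the Evans perturbation bound -/

/-- `‖KpairE K P‖ ≤ ‖K‖·‖P‖`. [folklore] -/
theorem norm_KpairE_le (hL : 0 < L) (K : EspE L hL →L[ℝ] W L) (P : WithLp 2 (EspE L hL × EspE L hL)) :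
    ‖KpairE hL K P‖ ≤ ‖K‖ * ‖P‖ := by
  obtain ⟨h1, h2⟩ := KpairE_fst_snd hL K P
  have hsq : ‖KpairE hL K P‖ ^ 2 ≤ (‖K‖ * ‖P‖) ^ 2 := by
    rw [WithLp.prod_norm_sq_eq_of_L2, h1, h2, mul_pow, WithLp.prod_norm_sq_eq_of_L2, mul_add]
    have a := K.le_opNorm P.fst
    have b := K.le_opNorm P.snd
    have ha : ‖K P.fst‖ ^ 2 ≤ (‖K‖ * ‖P.fst‖) ^ 2 := pow_le_pow_left₀ (norm_nonneg _) a 2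
    have hb : ‖K P.snd‖ ^ 2 ≤ (‖K‖ * ‖P.snd‖) ^ 2 := pow_le_pow_left₀ (norm_nonneg _) b 2
    nlinarith
  nlinarith [norm_nonneg (KpairE hL K P), norm_nonneg K, norm_nonneg P, mul_nonneg (norm_nonneg K) (norm_nonneg P)]

/-- **Cross-`K` absorption at the pair level.** For two Gårding data with the same drift/potential of record and perturbations `K`, `K'`
(`Re σ > −m`, `Re σ > −m'`): the `K`-solution pair `Q = pairOpKE_K σ G` solves the `K'`-system with data `G + ((K' − K)Q_R, (K' − K)Q_I)` on
zero-mass even tests, hence `pairOpKE_{K'} σ (G + KpairE (K' − K) Q) = Q` (uniqueness, `pairOpKE_unique`). [folklore] -/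
theorem pairOpKE_cross (h : GardingDataKE L hL d V K D₀ D₁ V₀ c m) (h' : GardingDataKE L hL d V K' D₀ D₁ V₀ c' m')
    {σ : ℂ} (hσ : -m < σ.re) (hσ' : -m' < σ.re) (G : WithLp 2 (W L × W L)) :
    pairOpKE hL K' h' σ hσ' (G + KpairE hL (K' - K) (pairOpKE hL K h σ hσ G)) = pairOpKE hL K h σ hσ G := by
  set Q := pairOpKE hL K h σ hσ G with hQ
  symm
  refine pairOpKE_unique hL K' h' σ hσ' _ fun v v₁ hv h0 => ?_
  obtain ⟨e1, e2⟩ := (pairOpKE_spec hL K h σ hσ).1 G v v₁ hv h0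
  have hd1 : ((G + KpairE hL (K' - K) Q).fst : W L) = G.fst + (K' - K) Q.fst := by
    rw [WithLp.add_fst, (KpairE_fst_snd hL (K' - K) Q).1]
  have hd2 : ((G + KpairE hL (K' - K) Q).snd : W L) = G.snd + (K' - K) Q.snd := by
    rw [WithLp.add_snd, (KpairE_fst_snd hL (K' - K) Q).2]
  rw [integral_weight_mul_eq_PdataE hL (K Q.fst) hv h0, integral_weight_mul_eq_PdataE hL G.fst hv h0] at e1
  rw [integral_weight_mul_eq_PdataE hL (K Q.snd) hv h0, integral_weight_mul_eq_PdataE hL G.snd hv h0] at e2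
  rw [integral_weight_mul_eq_PdataE hL (K' Q.fst) hv h0, integral_weight_mul_eq_PdataE hL (K' Q.snd) hv h0,
    integral_weight_mul_eq_PdataE hL ((G + KpairE hL (K' - K) Q).fst : W L) hv h0,
    integral_weight_mul_eq_PdataE hL ((G + KpairE hL (K' - K) Q).snd : W L) hv h0, hd1, hd2,
    map_add (PdataE hL), map_add (PdataE hL), LinearMap.add_apply, LinearMap.add_apply,
    _root_.sub_apply, _root_.sub_apply, map_sub (PdataE hL), map_sub (PdataE hL),
    LinearMap.sub_apply, LinearMap.sub_apply]
  constructor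
  · linarith
  · linarith

/-- **Cross-`K` difference at the pair level**: `pairOpKE_K σ G − pairOpKE_{K'} σ G = pairOpKE_{K'} σ (KpairE (K' − K) (pairOpKE_K σ G))`. [folklore] -/
theorem pairOpKE_sub_cross (h : GardingDataKE L hL d V K D₀ D₁ V₀ c m) (h' : GardingDataKE L hL d V K' D₀ D₁ V₀ c' m')
    {σ : ℂ} (hσ : -m < σ.re) (hσ' : -m' < σ.re) (G : WithLp 2 (W L × W L)) :
    pairOpKE hL K h σ hσ G - pairOpKE hL K' h' σ hσ' G =
      pairOpKE hL K' h' σ hσ' (KpairE hL (K' - K) (pairOpKE hL K h σ hσ G)) := by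
  have e := pairOpKE_cross h h' hσ hσ' G
  rw [map_add] at e
  exact sub_eq_of_eq_add' e.symm

/-- **THE CROSS-`K` SECOND RESOLVENT IDENTITY** on the complex pivot `L²_w(ℂ)`: for `Re σ > −m` and `Re σ > −m'`,
`R⁺_K(σ)G − R⁺_{K'}(σ)G = R⁺_{K'}(σ)·ofPair (KpairE (K' − K) (pairOpKE_K σ (toPair G)))`, i.e. `R⁺_K − R⁺_{K'} = R⁺_{K'}(K' − K)R⁺_K` with the
middle factor acting on the energy-space pair behind `R⁺_K(σ)G`. [folklore] -/
theorem resolventKE_sub_cross (h : GardingDataKE L hL d V K D₀ D₁ V₀ c m) (h' : GardingDataKE L hL d V K' D₀ D₁ V₀ c' m')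
    {σ : ℂ} (hσ : -m < σ.re) (hσ' : -m' < σ.re) (G : Wc L) :
    resolventKE hL K h σ G - resolventKE hL K' h' σ G =
      resolventKE hL K' h' σ (ofPair L (KpairE hL (K' - K) (pairOpKE hL K h σ hσ (toPair L G)))) := by
  obtain ⟨e1, -, -, -⟩ := resolventKE_weak hL K h hσ G
  obtain ⟨e2, -, -, -⟩ := resolventKE_weak hL K' h' hσ' G
  obtain ⟨e3, -, -, -⟩ := resolventKE_weak hL K' h' hσ' (ofPair L (KpairE hL (K' - K) (pairOpKE hL K h σ hσ (toPair L G))))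
  rw [e1, e2, e3, toPair_ofPair, ← map_sub, ← map_sub, pairOpKE_sub_cross h h' hσ hσ']

/-- **Norm bound for the cross-`K` difference**: `‖R⁺_K(σ)G − R⁺_{K'}(σ)G‖ ≤ ‖K' − K‖·(4/κ_c(σ))·‖G‖/(m' + Re σ)`
(`κ_c(σ) = min(c, 4(m + Re σ))` the `K`-datum's energy constant: `‖pairOpKE_K σ G‖_E ≤ (4/κ_c(σ))‖G‖`; `1/(m' + Re σ)` the `K'`-datum's sharp
pivot bound `norm_resolventKE_le_inv`). [folklore] -/
theorem norm_resolventKE_sub_cross_le (h : GardingDataKE L hL d V K D₀ D₁ V₀ c m) (h' : GardingDataKE L hL d V K' D₀ D₁ V₀ c' m')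
    {σ : ℂ} (hσ : -m < σ.re) (hσ' : -m' < σ.re) (G : Wc L) :
    ‖resolventKE hL K h σ G - resolventKE hL K' h' σ G‖ ≤
      ‖K' - K‖ * (4 / min c (4 * (m + σ.re))) * ‖G‖ / (m' + σ.re) := by
  rw [resolventKE_sub_cross h h' hσ hσ' G]
  set Q := pairOpKE hL K h σ hσ (toPair L G) with hQ
  have hm' : 0 < m' + σ.re := by linarith
  have h1 := norm_resolventKE_le_inv hL K' h' hσ' (ofPair L (KpairE hL (K' - K) Q))
  rw [norm_ofPair] at h1
  have h2 := norm_KpairE_le hL (K' - K) Q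
  have h3 := (pairOpKE_spec hL K h σ hσ).2 (toPair L G)
  rw [norm_toPair] at h3
  have h4 : ‖KpairE hL (K' - K) Q‖ ≤ ‖K' - K‖ * (4 / min c (4 * (m + σ.re))) * ‖G‖ :=
    h2.trans (by rw [mul_assoc]; exact mul_le_mul_of_nonneg_left h3 (norm_nonneg (K' - K)))
  exact h1.trans (by gcongr)

/-- **(P8⁺), Evans form on `L²_w(ℂ)`.** `|⟪h, R⁺_K(σ)G⟫ − ⟪h, R⁺_{K'}(σ)G⟫| ≤ ‖h‖·‖K' − K‖·(4/κ_c(σ))·‖G‖/(m' + Re σ)`. [folklore] -/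
theorem norm_inner_resolventKE_sub_cross_le (h : GardingDataKE L hL d V K D₀ D₁ V₀ c m)
    (h' : GardingDataKE L hL d V K' D₀ D₁ V₀ c' m') {σ : ℂ} (hσ : -m < σ.re) (hσ' : -m' < σ.re) (hv G : Wc L) :
    ‖⟪hv, resolventKE hL K h σ G⟫_ℂ - ⟪hv, resolventKE hL K' h' σ G⟫_ℂ‖ ≤
      ‖hv‖ * (‖K' - K‖ * (4 / min c (4 * (m + σ.re))) * ‖G‖ / (m' + σ.re)) := by
  rw [← inner_sub_right]
  exact (norm_inner_le_norm _ _).trans (mul_le_mul_of_nonneg_left (norm_resolventKE_sub_cross_le h h' hσ hσ' G) (norm_nonneg _))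

/-- **(P8⁺), Evans form on the even zero-mass class.** For `hv, G ∈ WcevenZ`: the same bound for the class resolvent `resolventEven`
(`coe_resolventEven`: it is `R⁺_K(σ)` restricted; inner products and norms of the subtype are those of `L²_w(ℂ)`). [folklore] -/
theorem norm_inner_resolventEven_sub_cross_le (h : GardingDataKE L hL d V K D₀ D₁ V₀ c m)
    (h' : GardingDataKE L hL d V K' D₀ D₁ V₀ c' m') {σ : ℂ} (hσ : -m < σ.re) (hσ' : -m' < σ.re) (hv G : WcevenZ hL) :
    ‖⟪hv, resolventEven hL K h σ G⟫_ℂ - ⟪hv, resolventEven hL K' h' σ G⟫_ℂ‖ ≤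
      ‖hv‖ * (‖K' - K‖ * (4 / min c (4 * (m + σ.re))) * ‖G‖ / (m' + σ.re)) := by
  rw [Submodule.coe_inner, Submodule.coe_inner, coe_resolventEven, coe_resolventEven]
  exact norm_inner_resolventKE_sub_cross_le h h' hσ hσ' (hv : Wc L) (G : Wc L)

/-- **(P8⁺), for the even Evans functions of selfsim g14** (`evansEven hL K h (innerSL ℂ hv) f θ w = 1 − θ⟪hv, R⁺_K(w) f⟫`):
`‖E⁺_{K'}(w) − E⁺_K(w)‖ ≤ ‖θ‖·‖hv‖·‖K' − K‖·(4/κ_c(w))·‖f‖/(m' + Re w)` for `Re w > −m, −m'`. [folklore] -/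
theorem norm_evansEven_sub_le (h : GardingDataKE L hL d V K D₀ D₁ V₀ c m) (h' : GardingDataKE L hL d V K' D₀ D₁ V₀ c' m')
    {w : ℂ} (hw : -m < w.re) (hw' : -m' < w.re) (hv f : WcevenZ hL) (θ : ℂ) :
    ‖evansEven hL K' h' (innerSL ℂ hv) f θ w - evansEven hL K h (innerSL ℂ hv) f θ w‖ ≤
      ‖θ‖ * (‖hv‖ * (‖K' - K‖ * (4 / min c (4 * (m + w.re))) * ‖f‖ / (m' + w.re))) := by
  rw [evansEven_apply, evansEven_apply, innerSL_apply_apply, innerSL_apply_apply]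
  have e : (1 - θ * ⟪hv, resolventEven hL K' h' w f⟫_ℂ) - (1 - θ * ⟪hv, resolventEven hL K h w f⟫_ℂ) =
      θ * (⟪hv, resolventEven hL K h w f⟫_ℂ - ⟪hv, resolventEven hL K' h' w f⟫_ℂ) := by ring
  rw [e, norm_mul]
  exact mul_le_mul_of_nonneg_left (norm_inner_resolventEven_sub_cross_le h h' hw hw' hv f) (norm_nonneg θ)

/-- **(P8⁺), UNIFORM on the closed half-plane `Re w ≥ −3/100`.** If `m ≥ 3/20` and `−m' < −3/100`, then for every `w` with `Re w ≥ −3/100`: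
`‖E⁺_{K'}(w) − E⁺_K(w)‖ ≤ ‖θ‖·‖hv‖·‖K' − K‖·(4/min(c, 4(m − 3/100)))·‖f‖/(m' − 3/100)` — the shape of the hypothesis `hpert` of
`SheetRSpectrumEvenPointAssembly.eq_half_of_pointDataE` / selfsim's `eigen_iff_eq_half`. [folklore] -/
theorem evansEven_pert_of_norm_le (h : GardingDataKE L hL d V K D₀ D₁ V₀ c m) (h' : GardingDataKE L hL d V K' D₀ D₁ V₀ c' m')
    (hm : (3 : ℝ) / 20 ≤ m) (hm' : -m' < ra) (hv f : WcevenZ hL) (θ : ℂ) :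
    ∀ w : ℂ, ra ≤ w.re → ‖evansEven hL K' h' (innerSL ℂ hv) f θ w - evansEven hL K h (innerSL ℂ hv) f θ w‖ ≤
      ‖θ‖ * (‖hv‖ * (‖K' - K‖ * (4 / min c (4 * (m + ra))) * ‖f‖ / (m' + ra))) := by
  intro w hw
  have hra : ra = -(3 : ℝ) / 100 := rfl
  have hmra : -m < ra := by rw [hra]; linarith
  have hσ : -m < w.re := lt_of_lt_of_le hmra hw
  have hσ' : -m' < w.re := lt_of_lt_of_le hm' hw
  have hκ₀ : 0 < min c (4 * (m + ra)) := kappaE_pos h hmra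
  have hm'ra : 0 < m' + ra := by linarith
  refine (norm_evansEven_sub_le h h' hσ hσ' hv f θ).trans (mul_le_mul_of_nonneg_left ?_ (norm_nonneg θ))
  have hmin : min c (4 * (m + ra)) ≤ min c (4 * (m + w.re)) := min_le_min le_rfl (by linarith)
  have hden : m' + ra ≤ m' + w.re := by linarith
  have h4 : 4 / min c (4 * (m + w.re)) ≤ 4 / min c (4 * (m + ra)) := div_le_div_of_nonneg_left (by norm_num) hκ₀ hmin
  have hnum : ‖K' - K‖ * (4 / min c (4 * (m + w.re))) * ‖f‖ ≤ ‖K' - K‖ * (4 / min c (4 * (m + ra))) * ‖f‖ := by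
    gcongr
  have hnn : 0 ≤ ‖K' - K‖ * (4 / min c (4 * (m + ra))) * ‖f‖ := by positivity
  refine mul_le_mul_of_nonneg_left ?_ (norm_nonneg hv)
  calc ‖K' - K‖ * (4 / min c (4 * (m + w.re))) * ‖f‖ / (m' + w.re)
      ≤ ‖K' - K‖ * (4 / min c (4 * (m + ra))) * ‖f‖ / (m' + w.re) :=
        div_le_div_of_nonneg_right hnum (by linarith)
    _ ≤ ‖K' - K‖ * (4 / min c (4 * (m + ra))) * ‖f‖ / (m' + ra) :=
        div_le_div_of_nonneg_left hnn hm'ra hden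

/-! ### §3 The (P8⁺) allowance at the literals of record -/

section Record

open CertificateViscousSheetRSpectrum (c1 c2 gamma)
open CertificateViscousSheetRSpectrumEven (DeltaE hw2E LlipE)
open CertificateViscousSheetR (rEsharp2)

/-- `0 ≤ Δ⁺ ≤ 1.374e-5` as real numbers (`DeltaE = LlipE·rE♯₂`). [folklore] -/
theorem DeltaE_real_bounds : (0 : ℝ) ≤ ((DeltaE : ℚ) : ℝ) ∧ ((DeltaE : ℚ) : ℝ) ≤ (1374 : ℝ) / 100000000 := by
  refine ⟨by norm_num [DeltaE, LlipE, rEsharp2], by norm_num [DeltaE, LlipE, rEsharp2]⟩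

/-- **The even (P8⁺) allowance at the literals of record is below `pert⁺ = 1107/200000`**:
`4·(hw2E·(Δ⁺/2)·20)·4/(3/25 − Δ⁺/4) ≤ 1107/200000` (`Δ⁺ = LlipE·rE♯₂ ≈ 1.3732e-5`, `hw2E = 1.00758…`; value ≈ 0.00462; the registered
`pert⁺_hi = 5.5347e-3` of `CertificateViscousSheetRSpectrumEvenB.pertEB` and cert-2 g10's `1107/200000` both dominate it). [folklore] -/
theorem pert_of_record_leE :
    (4 : ℝ) * (((hw2E : ℚ) : ℝ) * (((DeltaE : ℚ) : ℝ) / 2 * 20)) / ((3 : ℝ) / 25 - ((DeltaE : ℚ) : ℝ) / 4) ≤ (1107 : ℝ) / 200000 := by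
  norm_num [hw2E, DeltaE, LlipE, rEsharp2]

/-- **(P8⁺), S1 clause at the literals of record.** A centre datum `(c, m)` and `‖K' − K‖ ≤ Δ⁺/2` with `Δ⁺ < c` give the datum
`(c − Δ⁺, m − Δ⁺/4)` for `K'`. MODEL statement; not NS. [folklore] -/
theorem gardingDataKE_of_record (h : GardingDataKE L hL d V K D₀ D₁ V₀ c m) (K' : EspE L hL →L[ℝ] W L)
    (hKK : ‖K' - K‖ ≤ ((DeltaE : ℚ) : ℝ) / 2) (hc : ((DeltaE : ℚ) : ℝ) < c) :
    GardingDataKE L hL d V K' D₀ D₁ V₀ (c - ((DeltaE : ℚ) : ℝ)) (m - ((DeltaE : ℚ) : ℝ) / 4) := by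
  have key := gardingDataKE_of_norm_sub_le h K' hKK (by linarith)
  convert key using 2 <;> ring

/-- With `m ≥ c₁ + γ = 3/20`: the perturbed abscissa satisfies `−(m − Δ⁺/4) < −3/100` (and `c − Δ⁺ > 0` when `c ≥ c₂ = 1/5`). [folklore] -/
theorem neg_mstar_lt_raE (hm : ((c1 : ℚ) : ℝ) + ((gamma : ℚ) : ℝ) ≤ m) : -(m - ((DeltaE : ℚ) : ℝ) / 4) < ra := by
  have hra : ra = -(3 : ℝ) / 100 := rfl
  have hcg : ((c1 : ℚ) : ℝ) + ((gamma : ℚ) : ℝ) = 3 / 20 := by norm_num [c1, gamma]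
  obtain ⟨-, hD1⟩ := DeltaE_real_bounds
  rw [hra]; linarith

/-- `Δ⁺ < c` when `c ≥ c₂ = 1/5`. [folklore] -/
theorem DeltaE_lt_of_c2_le (hc : ((c2 : ℚ) : ℝ) ≤ c) : ((DeltaE : ℚ) : ℝ) < c := by
  have hc2 : ((c2 : ℚ) : ℝ) = 1 / 5 := by norm_num [c2]
  obtain ⟨-, hD1⟩ := DeltaE_real_bounds
  linarith

/-- **THE (P8⁺) ALLOWANCE OF THE EVEN ASSEMBLY, DISCHARGED.** Centre datum `(c, m)` with `c ≥ c₂ = 1/5`, `m ≥ c₁ + γ = 3/20`; ANY second datum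
`(c', m')` for `K'` with `m' ≥ m − Δ⁺/4`; `‖K' − K‖ ≤ Δ⁺/2`; `θ = 4`; lift datum `f = hv` with `‖hv‖² ≤ hw2E`.  Then for every `w` with `Re w ≥ −3/100`:
`‖E⁺_{K'}(w) − E⁺_K(w)‖ ≤ 4·(hw2E·(Δ⁺/2)·20)·… /(3/25 − Δ⁺/4) =: pert₀` and `pert₀ ≤ 1107/200000` — EXACTLY the pair of hypotheses `hpert`, `hpert'`
of `SheetRSpectrumEvenPointAssembly.eq_half_of_pointDataE` / selfsim's `SheetRSpectrumEvenAssembly.eigen_iff_eq_half`. MODEL statement; not NS. [folklore] -/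
theorem evansEven_pert_of_record (h : GardingDataKE L hL d V K D₀ D₁ V₀ c m) {K' : EspE L hL →L[ℝ] W L}
    (h' : GardingDataKE L hL d V K' D₀ D₁ V₀ c' m')
    (hc : ((c2 : ℚ) : ℝ) ≤ c) (hm : ((c1 : ℚ) : ℝ) + ((gamma : ℚ) : ℝ) ≤ m) (hm' : m - ((DeltaE : ℚ) : ℝ) / 4 ≤ m')
    (hKK : ‖K' - K‖ ≤ ((DeltaE : ℚ) : ℝ) / 2) (hv : WcevenZ hL) (hhw : ‖hv‖ ^ 2 ≤ ((hw2E : ℚ) : ℝ)) :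
    (∀ w : ℂ, ra ≤ w.re → ‖evansEven hL K' h' (innerSL ℂ hv) hv 4 w - evansEven hL K h (innerSL ℂ hv) hv 4 w‖ ≤
        (4 : ℝ) * (((hw2E : ℚ) : ℝ) * (((DeltaE : ℚ) : ℝ) / 2 * 20)) / ((3 : ℝ) / 25 - ((DeltaE : ℚ) : ℝ) / 4)) ∧
      (4 : ℝ) * (((hw2E : ℚ) : ℝ) * (((DeltaE : ℚ) : ℝ) / 2 * 20)) / ((3 : ℝ) / 25 - ((DeltaE : ℚ) : ℝ) / 4) ≤ (1107 : ℝ) / 200000 := by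
  have hra : ra = -(3 : ℝ) / 100 := rfl
  have hc2 : ((c2 : ℚ) : ℝ) = 1 / 5 := by norm_num [c2]
  have hcg : ((c1 : ℚ) : ℝ) + ((gamma : ℚ) : ℝ) = 3 / 20 := by norm_num [c1, gamma]
  obtain ⟨hD0, hD1⟩ := DeltaE_real_bounds
  have hm₀ : (3 : ℝ) / 20 ≤ m := by linarith
  have hm'ra : -m' < ra := by rw [hra]; linarith
  refine ⟨fun w hw => ?_, pert_of_record_leE⟩
  have key := evansEven_pert_of_norm_le h h' hm₀ hm'ra hv hv (4 : ℂ) w hw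
  -- the scalar inequality
  have hκ : (1 : ℝ) / 5 ≤ min c (4 * (m + ra)) := le_min (by linarith) (by rw [hra]; linarith)
  have hκ0 : 0 < min c (4 * (m + ra)) := lt_of_lt_of_le (by norm_num) hκ
  have h4κ : 4 / min c (4 * (m + ra)) ≤ 20 := by
    rw [div_le_iff₀ hκ0]; linarith
  have hden : (3 : ℝ) / 25 - ((DeltaE : ℚ) : ℝ) / 4 ≤ m' + ra := by rw [hra]; linarith
  have hden0 : 0 < (3 : ℝ) / 25 - ((DeltaE : ℚ) : ℝ) / 4 := by linarith
  have hnum : ‖hv‖ * (‖K' - K‖ * (4 / min c (4 * (m + ra))) * ‖hv‖) ≤ ((hw2E : ℚ) : ℝ) * (((DeltaE : ℚ) : ℝ) / 2 * 20) := by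
    calc ‖hv‖ * (‖K' - K‖ * (4 / min c (4 * (m + ra))) * ‖hv‖) = ‖hv‖ ^ 2 * (‖K' - K‖ * (4 / min c (4 * (m + ra)))) := by ring
      _ ≤ ((hw2E : ℚ) : ℝ) * (((DeltaE : ℚ) : ℝ) / 2 * 20) := by
          refine mul_le_mul hhw (mul_le_mul hKK h4κ (by positivity) (by positivity)) (by positivity) ?_
          exact le_trans (by positivity) hhw
  have hDpos : 0 < m' + ra := lt_of_lt_of_le hden0 hden
  have hLHS0 : 0 ≤ ‖hv‖ * (‖K' - K‖ * (4 / min c (4 * (m + ra))) * ‖hv‖) := by positivity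
  have hN0 : 0 ≤ 4 * (((hw2E : ℚ) : ℝ) * (((DeltaE : ℚ) : ℝ) / 2 * 20)) := by nlinarith [hnum, hLHS0]
  have h4 : ‖(4 : ℂ)‖ = 4 := by simp
  have e : ‖(4 : ℂ)‖ * (‖hv‖ * (‖K' - K‖ * (4 / min c (4 * (m + ra))) * ‖hv‖ / (m' + ra))) =
      4 * (‖hv‖ * (‖K' - K‖ * (4 / min c (4 * (m + ra))) * ‖hv‖)) / (m' + ra) := by
    rw [h4]; ring
  rw [e] at key
  refine key.trans ?_
  calc 4 * (‖hv‖ * (‖K' - K‖ * (4 / min c (4 * (m + ra))) * ‖hv‖)) / (m' + ra)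
      ≤ 4 * (((hw2E : ℚ) : ℝ) * (((DeltaE : ℚ) : ℝ) / 2 * 20)) / (m' + ra) :=
        div_le_div_of_nonneg_right (by linarith [hnum]) hDpos.le
    _ ≤ 4 * (((hw2E : ℚ) : ℝ) * (((DeltaE : ℚ) : ℝ) / 2 * 20)) / ((3 : ℝ) / 25 - ((DeltaE : ℚ) : ℝ) / 4) :=
        div_le_div_of_nonneg_left hN0 hden0 hden

/-- **(P8⁺) for `K' := K + B`, `‖B‖ ≤ Δ⁺/2`, with the TRANSFERRED datum** (`gardingDataKE_of_record`; no second datum assumed): the same two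
conclusions, the second Evans function being `evansEven hL K' (gardingDataKE_of_record h K' hKK _) …`. MODEL statement; not NS. [folklore] -/
theorem evansEven_pert_of_record' (h : GardingDataKE L hL d V K D₀ D₁ V₀ c m) (K' : EspE L hL →L[ℝ] W L) (hc : ((c2 : ℚ) : ℝ) ≤ c)
    (hm : ((c1 : ℚ) : ℝ) + ((gamma : ℚ) : ℝ) ≤ m)
    (hKK : ‖K' - K‖ ≤ ((DeltaE : ℚ) : ℝ) / 2) (hv : WcevenZ hL) (hhw : ‖hv‖ ^ 2 ≤ ((hw2E : ℚ) : ℝ)) :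
    (∀ w : ℂ, ra ≤ w.re →
        ‖evansEven hL K' (gardingDataKE_of_record h K' hKK (DeltaE_lt_of_c2_le hc)) (innerSL ℂ hv) hv 4 w
            - evansEven hL K h (innerSL ℂ hv) hv 4 w‖ ≤
          (4 : ℝ) * (((hw2E : ℚ) : ℝ) * (((DeltaE : ℚ) : ℝ) / 2 * 20)) / ((3 : ℝ) / 25 - ((DeltaE : ℚ) : ℝ) / 4)) ∧
      (4 : ℝ) * (((hw2E : ℚ) : ℝ) * (((DeltaE : ℚ) : ℝ) / 2 * 20)) / ((3 : ℝ) / 25 - ((DeltaE : ℚ) : ℝ) / 4) ≤ (1107 : ℝ) / 200000 :=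
  evansEven_pert_of_record h (gardingDataKE_of_record h K' hKK (DeltaE_lt_of_c2_le hc)) hc hm le_rfl hKK hv hhw

end Record

end SheetREvenLinearisationPerturbation
end Summit.NavierStokesRegularity.OSWSelfSimilar

end
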